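import Summits.Ventures.MM22.Rank333.Root21CliqueCover
import Summits.Ventures.MM22.Rank333.ProfileSATEncode
import HarnessLib

/-!
# MM22 venture — root `R_𝔽₂(⟨3,3,3⟩) ≥ 21`, LRAT kernel route (0″): the DICTIONARY «computation ↦ instance solution»

HONEST FRAMING (cell `pub-mm22`, seat engine-2 g3). This file links the finite `ProfileSAT.Inst` statements of the
M2-split data files to the cell's certificate vocabulary (`Cert 3 3 3 K b`, `Root21CliqueCover.lean`): given CASE DATA
(forced forms `F`, excluded forms `X`, forms `R3` carrying bound 20, the ordered free forms, and for each row a pair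
`(K, t)` with `Cert 3 3 3 K t`), every bilinear computation of `(X, Y) ↦ X Y` on `3 × 3` matrices over `𝔽₂` with at most
20 products, in normal form (`exists_normal`) and lying in the case (`F ⊆` its forms, none in `X`), yields a SOLUTION of the
instance (`Inst.sol_of_normalForm`). Hence a kernel theorem `∀ x, ¬ I.Sol x` (data files) excludes all computations of the
case. NOT here: the coverage of all computations by the cases, and the certificates `Cert 3 3 3 K t` themselves (they are
hypotheses: Wang's values / the cell's LP lifts). No rank bound is claimed.
-/

namespace Summit.Ventures.MM22.ProfileSAT

open Summit.MatrixMultiplication.OmegaCensus.GF2RankLB Literature.Computability.AlgebraicComplexity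
open Summit.Ventures.MM22.GF2Cert Summit.Ventures.MM22 Summit.Ventures.MM22.GF2Cert.Root21


/-! ## Case data and its consistency with an instance -/

/-- Case data of an M2-split sub-case: forced forms `F`, excluded forms `X`, forms `R3` that carry bound 20 (rank 3),
the free forms in variable order, and per row the certified pair `(K, t)` («every computation on `S_K` needs `≥ t`»). -/
structure CaseData where
  /-- forced forms -/
  F : List ℕ
  /-- excluded forms -/
  X : List ℕ
  /-- forms with single-form bound 20 -/
  R3 : List ℕ
  /-- free forms, in variable order -/
  free : List ℕ
  /-- per row: constraint list `K` and certified bound `t` -/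
  dict : List (List ℕ × ℕ)

/-- Positions (variables) of the free forms lying in `K`. -/
def idxIn (free K : List ℕ) : List ℕ := (List.range free.length).filter fun j => free.getD j 0 ∈ K

/-- Consistency of case data with an instance: `F, free` duplicate-free and disjoint; every form is rank-3, forced,
excluded or free; `n = |free|`, `k + |F| = 20`; row `j` of the instance is `(idxIn free K_j, cap_j)` with
`t_j + |F ∩ K_j| + cap_j = 20`. -/
def CaseData.OK (D : CaseData) (I : Inst) : Prop :=
  (D.F ++ D.free).Nodup ∧
  (∀ f ∈ allForms, f ∈ D.R3 ∨ f ∈ D.F ∨ f ∈ D.X ∨ f ∈ D.free) ∧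
  I.n = D.free.length ∧ I.k + D.F.length = 20 ∧ I.rows.length = D.dict.length ∧
  ∀ j < D.dict.length,
    (I.rows.getD j ([], 0)).1 = idxIn D.free (D.dict.getD j ([], 0)).1 ∧
    (D.dict.getD j ([], 0)).2 + (D.F.filter fun f => f ∈ (D.dict.getD j ([], 0)).1).length +
      (I.rows.getD j ([], 0)).2 = 20

/-- Consistency is decidable (checked by `decide` in the data files). -/
instance (D : CaseData) (I : Inst) : Decidable (D.OK I) := by
  unfold CaseData.OK; infer_instance

/-! ## Counting helpers -/

/-- Counting over positions equals counting over the list. -/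
theorem countP_range_getD (P : ℕ → Bool) : ∀ (l : List ℕ),
    (List.range l.length).countP (fun j => P (l.getD j 0)) = l.countP P
  | [] => by simp
  | a :: l => by
    rw [List.length_cons, List.range_succ_eq_map, List.countP_cons, List.countP_map]
    have : (List.range l.length).countP ((fun j => P ((a :: l).getD j 0)) ∘ Nat.succ) =
        (List.range l.length).countP (fun j => P (l.getD j 0)) :=
      List.countP_congr fun j _ => by simp
    rw [this, countP_range_getD P l, List.countP_cons]
    simp

/-- For a duplicate-free list, counting membership in a finset is an intersection cardinality. -/
theorem countP_mem_eq_card (l : List ℕ) (hl : l.Nodup) (s : Finset ℕ) :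
    l.countP (fun f => decide (f ∈ s)) = (l.toFinset ∩ s).card := by
  rw [List.countP_eq_length_filter, ← List.toFinset_card_of_nodup (hl.filter _), List.toFinset_filter]
  congr 1
  ext f
  simp [Finset.mem_inter]

/-! ## The dictionary theorem -/

/-- **Computation ↦ solution.** Under consistent case data with certified rows, single-form bounds 19 for all forms
and 20 for `R3`, a normal-form computation of `ψ_{[]}` with `r ≤ 20` products whose forms contain `F` and avoid `X`
yields a solution of the instance: variable `j` is «the `j`-th free form occurs». -/
theorem Inst.sol_of_normalForm (D : CaseData) (I : Inst) (hok : D.OK I)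
    (hdict : ∀ e ∈ D.dict, Cert 3 3 3 e.1 e.2)
    (h19 : ∀ f ∈ allForms, Cert 3 3 3 [f] 19) (h20 : ∀ f ∈ D.R3, Cert 3 3 3 [f] 20)
    {r : ℕ} (β : BilinComp (psiK 3 3 3 []) (Fin r)) (hr : r ≤ 20) (c : Fin r → ℕ)
    (hc : ∀ i (u : subOf 3 3 []), β.f i u = form 3 3 (c i) u) (hcA : ∀ i, c i ∈ allForms)
    (hF : ∀ f ∈ D.F, ∃ i, c i = f) (hX : ∀ i, c i ∉ D.X) :
    I.Sol (fun j => decide (∃ i, c i = D.free.getD j 0)) := by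
  classical
  obtain ⟨hnd, hcover, hn, hk, hlen, hrows⟩ := hok
  -- (1) c is injective; (2) r = 20; (3) no form of bound 20
  have hinj : Function.Injective c := by
    intro i j hij
    by_contra hne
    have h := add_card_le_of_cert β c hc [c i] {i, j}
      (fun i' hi' => by
        simp only [Finset.mem_insert, Finset.mem_singleton] at hi'
        rcases hi' with rfl | rfl
        · exact List.mem_cons_self
        · rw [← hij]; exact List.mem_cons_self) (h19 _ (hcA i))
    rw [Finset.card_pair hne] at h
    omega
  have hr20 : r = 20 := by
    obtain ⟨i₀, _⟩ := exists_f_ne_zero β psiK_nil_ne_zero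
    have h := add_card_le_of_cert β c hc [c i₀] {i₀} (fun i hi => by simp [Finset.mem_singleton.1 hi]) (h19 _ (hcA i₀))
    simp only [Finset.card_singleton] at h
    omega
  have hR3 : ∀ i, c i ∉ D.R3 := by
    intro i hi
    have h := add_card_le_of_cert β c hc [c i] {i} (fun i' hi' => by simp [Finset.mem_singleton.1 hi']) (h20 _ hi)
    simp only [Finset.card_singleton] at h
    omega
  -- finsets
  set img : Finset ℕ := Finset.univ.image c with himg
  set Ff : Finset ℕ := D.F.toFinset with hFf
  set Fr : Finset ℕ := D.free.toFinset with hFr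
  have hcard : img.card = 20 := by rw [himg, Finset.card_image_of_injective _ hinj]; simp [hr20]
  have hFsub : Ff ⊆ img := by
    intro f hf
    rw [hFf, List.mem_toFinset] at hf
    obtain ⟨i, hi⟩ := hF f hf
    rw [himg, Finset.mem_image]
    exact ⟨i, Finset.mem_univ _, hi⟩
  have hnodupF : D.F.Nodup := hnd.of_append_left
  have hnodupFree : D.free.Nodup := hnd.of_append_right
  have hdisj : Disjoint Ff Fr := by
    rw [hFf, hFr, Finset.disjoint_left]
    intro f hf hf'
    rw [List.mem_toFinset] at hf hf'
    exact List.disjoint_of_nodup_append hnd hf hf'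
  have himgsub : img ⊆ Ff ∪ Fr := by
    intro f hf
    rw [himg, Finset.mem_image] at hf
    obtain ⟨i, _, rfl⟩ := hf
    rcases hcover _ (hcA i) with h | h | h | h
    · exact absurd h (hR3 i)
    · exact Finset.mem_union_left _ (by rw [hFf, List.mem_toFinset]; exact h)
    · exact absurd h (hX i)
    · exact Finset.mem_union_right _ (by rw [hFr, List.mem_toFinset]; exact h)
  have hFcard : Ff.card = D.F.length := by rw [hFf, List.toFinset_card_of_nodup hnodupF]
  -- the assignment reads membership in `img`
  have hx : (fun j => decide (∃ i, c i = D.free.getD j 0)) = fun j => decide (D.free.getD j 0 ∈ img) := by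
    funext j
    rw [himg]
    simp only [Finset.mem_image, Finset.mem_univ, true_and]
  rw [hx]
  -- split of `img` along `Ff`/`Fr`
  have hsplit : ∀ s : Finset ℕ, (img ∩ s).card = (Ff ∩ s).card + (Fr ∩ img ∩ s).card := by
    intro s
    have e : img ∩ s = (Ff ∩ s) ∪ (Fr ∩ img ∩ s) := by
      ext f
      simp only [Finset.mem_inter, Finset.mem_union]
      constructor
      · rintro ⟨hf, hs⟩
        rcases Finset.mem_union.1 (himgsub hf) with h | h
        · exact Or.inl ⟨h, hs⟩
        · exact Or.inr ⟨⟨h, hf⟩, hs⟩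
      · rintro (⟨h, hs⟩ | ⟨⟨_, hf⟩, hs⟩)
        · exact ⟨hFsub h, hs⟩
        · exact ⟨hf, hs⟩
    rw [e, Finset.card_union_of_disjoint]
    exact Finset.disjoint_left.2 fun f h1 h2 =>
      Finset.disjoint_left.1 hdisj (Finset.mem_inter.1 h1).1 (Finset.mem_inter.1 (Finset.mem_inter.1 h2).1).1
  have hFfimg : Ff ∩ img = Ff := Finset.inter_eq_left.2 hFsub
  constructor
  · -- exactly k free forms occur
    rw [cnt, hn, countP_range_getD (fun f => decide (f ∈ img)) D.free, countP_mem_eq_card _ hnodupFree, ← hFr]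
    have h := hsplit img
    rw [Finset.inter_self, hFfimg, Finset.inter_assoc, Finset.inter_self, hcard, hFcard] at h
    omega
  · -- every row cap is met
    intro row hrow
    obtain ⟨j, hj, hjrow⟩ := List.getElem_of_mem hrow
    have hj' : j < D.dict.length := by rw [← hlen]; exact hj
    obtain ⟨hmem, hcap⟩ := hrows j hj'
    have erow : I.rows.getD j ([], 0) = row := by rw [List.getD_eq_getElem _ _ hj, hjrow]
    rw [erow] at hmem hcap
    set K := (D.dict.getD j ([], 0)).1 with hK
    set t := (D.dict.getD j ([], 0)).2 with ht
    have hKt : Cert 3 3 3 K t := by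
      have hm : D.dict.getD j ([], 0) ∈ D.dict := by
        rw [List.getD_eq_getElem _ _ hj']; exact List.getElem_mem hj'
      exact hdict _ hm
    set Kf : Finset ℕ := K.toFinset with hKf
    -- substitution count for the row
    let J : Finset (Fin r) := Finset.univ.filter fun i => c i ∈ Kf
    have hJ := add_card_le_of_cert β c hc K J
      (fun i hi => by
        have := (Finset.mem_filter.1 hi).2
        rwa [hKf, List.mem_toFinset] at this) hKt
    have hJimg : J.image c = img ∩ Kf := by
      ext f
      simp only [J, Finset.mem_image, Finset.mem_filter, Finset.mem_univ, true_and, Finset.mem_inter, himg]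
      constructor
      · rintro ⟨i, hi, rfl⟩; exact ⟨⟨i, rfl⟩, hi⟩
      · rintro ⟨⟨i, rfl⟩, hf⟩; exact ⟨i, hf, rfl⟩
    have hJcard : J.card = (Ff ∩ Kf).card + (Fr ∩ img ∩ Kf).card := by
      rw [← Finset.card_image_of_injective J hinj, hJimg, hsplit Kf]
    -- the three list counts as finset cardinalities
    have hcnt : cnt (fun j => decide (D.free.getD j 0 ∈ img)) (idxIn D.free K) = (Fr ∩ img ∩ Kf).card := by
      rw [cnt, idxIn, List.countP_filter]
      have e1 : (List.range D.free.length).countP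
            (fun j => decide (D.free.getD j 0 ∈ img) && decide (D.free.getD j 0 ∈ K)) =
          D.free.countP (fun f => decide (f ∈ img ∩ Kf)) := by
        rw [← countP_range_getD (fun f => decide (f ∈ img ∩ Kf)) D.free]
        refine List.countP_congr fun j _ => ?_
        simp [hKf, Finset.mem_inter]
      rw [e1, countP_mem_eq_card _ hnodupFree, ← Finset.inter_assoc]
    have hFK : (D.F.filter fun f => f ∈ K).length = (Ff ∩ Kf).card := by
      rw [← countP_mem_eq_card _ hnodupF, List.countP_eq_length_filter]
      congr 1
      refine List.filter_congr fun f _ => ?_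
      simp [hKf]
    rw [hmem, hcnt]
    rw [hFK] at hcap
    omega

/-- **No computation in a refuted case.** If the instance of a consistent case has no solution (a kernel theorem of the
data files), no normal-form computation with at most 20 products lies in the case. -/
theorem noComp_of_case (D : CaseData) (I : Inst) (hok : D.OK I) (hno : ∀ x, ¬ I.Sol x)
    (hdict : ∀ e ∈ D.dict, Cert 3 3 3 e.1 e.2)
    (h19 : ∀ f ∈ allForms, Cert 3 3 3 [f] 19) (h20 : ∀ f ∈ D.R3, Cert 3 3 3 [f] 20)
    {r : ℕ} (β : BilinComp (psiK 3 3 3 []) (Fin r)) (hr : r ≤ 20) (c : Fin r → ℕ)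
    (hc : ∀ i (u : subOf 3 3 []), β.f i u = form 3 3 (c i) u) (hcA : ∀ i, c i ∈ allForms)
    (hF : ∀ f ∈ D.F, ∃ i, c i = f) (hX : ∀ i, c i ∉ D.X) : False :=
  hno _ (Inst.sol_of_normalForm D I hok hdict h19 h20 β hr c hc hcA hF hX)

end Summit.Ventures.MM22.ProfileSAT
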